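import Mathlib.RepresentationTheory.Homological.GroupCohomology.LowDegree
import Mathlib.RepresentationTheory.Invariants
import Mathlib.LinearAlgebra.Matrix.GeneralLinearGroup.Defs
import Mathlib.LinearAlgebra.Matrix.ToLin
import Mathlib.Data.ZMod.Basic
import Mathlib.Data.ZMod.Units
import HarnessLib

/-!
# X11b at `p = 3` (team N8/O2), sub-target S7 · IMG3b: Sah's lemma — a central element acting
# invertibly-minus-one kills `H¹` and the invariants; at `p = 3`: `−1 ∈ G ≤ GL₂(ℤ/3^m)` gives
# `H¹(G, (ℤ/3^m)²) = 0` and `((ℤ/3^m)²)^G = 0`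

HONEST FRAMING (cell `b2b-bsdres`, run/shared/lean/b2b/bsd-rank1-residual/, verbatim in every
file): the goal of the cell is to DELETE the COMBINATION-SHAPED residual classes of the
Birch–Swinnerton-Dyer formula for ALL analytic-rank `≤ 1` elliptic curves over `ℚ` — "full BSD
formula for every rank `≤ 1` curve in class `C`" assembled STRICTLY from published theorems — so
that the rank-`≤ 1` remainder becomes exactly the CONSTRUCTION-SHAPED classes, which are TYPED
(missing-input `Prop`s), NOT attempted. This is not "finishing BSD". Team N8/O2 = `x11b3` (X11b at
`p = 3`), seat `b2b-bsdres-x11b3-p1`, sub-target S7 of `cells/x11b3/PLAN.md` (LEAD DEAL #2: "first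
skeleton filed owns it"). Pure group cohomology; nothing specific to elliptic curves; nothing is
booked; no label changes. THEOREMS ONLY (no definition, no named fact, no `sorry`).

## Why the team needs this (PLAN §1 "p = 3-ONLY phenomena", §2 S7, S3, K4)

At `p ≥ 5` the Kolyvagin-system / control arguments use "`p ∤ #ρ̄(G)` ⇒ `H¹(ρ̄(G), E[p]) = 0`"
(Howard 2004 §1.1 / Mazur–Rubin (H.1)–(H.3)-type checks) and "no `G`-fixed vectors". At `p = 3`,
`3 ∣ #GL₂(𝔽₃) = 48`, so the coprime-order shortcut dies. The substitute is **Sah's lemma**: if a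
CENTRAL element `z` of `G` acts on the module `A` so that `ρ(z) − 1` is invertible, then
`H¹(G, A) = 0` and `A^G = 0`. With `z = −1 ∈ G ≤ GL₂(ℤ/3^m)` acting as `−1` on `(ℤ/3^m)²`,
`ρ(z) − 1 = −2` is invertible because `2 ∈ (ℤ/3^m)^×`. The hypothesis "`−1 ∈ G`" is carried AT EACH
LEVEL `3^m` (lead's note 2026-08-21T05:07Z: not automatic from level `3`; automatic under
`towerSurj(3)`, census bit (h)); no claim is made about when it holds.

## Contents

* §1 (any commutative ring `k`, any group `G`, any `A : Rep k G`):
  `Sah.cocycles₁_le_coboundaries₁_of_isUnit` — `z` central, `IsUnit (A.ρ z − 1)` ⇒ every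
  `1`-cocycle is a `1`-coboundary (`f(g) = (ρ g − 1)((ρ z − 1)⁻¹ f(z))`);
  `Sah.isZero_H1_of_isUnit` — `IsZero (groupCohomology.H1 A)`;
  `Sah.invariants_eq_bot_of_isUnit` — `A^G = 0` (indeed `A^z = 0`).
* §2 the case `A.ρ z = −1` with `IsUnit (2 : k)`: `Sah.isUnit_rho_sub_one_of_eq_neg_one`,
  `Sah.isZero_H1_of_eq_neg_one`, `Sah.invariants_eq_bot_of_eq_neg_one`, and the CONCRETE
  crossed-homomorphism form `Sah.exists_eq_sub_of_crossedHom_of_eq_neg_one` /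
  `Sah.eq_zero_of_forall_fixed_of_eq_neg_one` for any `ρ : Representation k G M` (the shape S3 /
  K4 consume: `E[3^m]` with its Galois action, `−1` in the image).
* §3 the instance of the PLAN row: `G ≤ GL₂(ℤ/3^m)` with `−1 ∈ G` acting on `(ℤ/3^m)²` by
  `mulVec`: `GL2.eq_zero_of_forall_mulVec_eq` (no fixed vectors) and
  `GL2.exists_eq_mulVec_sub_of_crossedHom` (every crossed homomorphism is principal), for every
  `m` (stated for `3^m` as in the PLAN; the same proof works for any odd modulus).

References: C.-H. Sah, *Automorphisms of finite groups*, J. Algebra 10 (1968) (the lemma in the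
form "central element acting without fixed points kills `H¹`"; standard, e.g. Lang, *Elliptic
curves: Diophantine analysis*, or Serre's use in *Abelian ℓ-adic representations* IV); B. Howard,
Compositio 140 (2004) §1.1; team file `cells/x11b3/PLAN.md` §2 S7.
-/

universe u

namespace Summit.BirchSwinnertonDyer.Rank1Residual.X11b.Three

namespace Sah

open groupCohomology CategoryTheory

/-! ### §1 Sah's lemma for `Rep k G` -/

section General

variable {k G : Type u} [CommRing k] [Group G] (A : Rep k G)

/-- **Sah's lemma, cocycle form.** If `z ∈ G` commutes with every element of `G` and `ρ(z) − 1`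
is invertible on `A`, then every `1`-cocycle `f : G → A` is a `1`-coboundary: comparing
`f(gz) = f(zg)` gives `(ρ z − 1) f(g) = (ρ g − 1) f(z)`, so `f(g) = (ρ g − 1) a` with
`a = (ρ z − 1)⁻¹ f(z)` (the inverse commutes with every `ρ g`). [folklore] -/
theorem cocycles₁_le_coboundaries₁_of_isUnit (z : G) (hz : ∀ g : G, g * z = z * g)
    (hu : IsUnit (A.ρ z - 1)) : cocycles₁ A ≤ coboundaries₁ A := by
  intro f hf
  rw [mem_cocycles₁_iff] at hf
  obtain ⟨u, hu'⟩ := hu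
  -- the candidate `a = u⁻¹ (f z)`
  refine ⟨(↑u⁻¹ : Module.End k A) (f z), funext fun g => ?_⟩
  -- `ρ g` commutes with `ρ z`, hence with `u = ρ z − 1` and with `u⁻¹`
  have hgz : Commute (A.ρ g) (A.ρ z) := by
    change A.ρ g * A.ρ z = A.ρ z * A.ρ g
    rw [← map_mul, hz g, map_mul]
  have hcomm : Commute (A.ρ g - 1) (↑u : Module.End k A) := by
    rw [hu']
    exact (hgz.sub_left (Commute.one_left _)).sub_right (Commute.one_right _)
  have hcomm' : Commute (A.ρ g - 1) (↑u⁻¹ : Module.End k A) := hcomm.units_inv_right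
  -- the key identity `(ρ z − 1) (f g) = (ρ g − 1) (f z)`
  have h1 := hf g z
  have h2 := hf z g
  rw [hz g] at h1
  have hkey : (↑u : Module.End k A) (f g) = (A.ρ g - 1) (f z) := by
    rw [hu', LinearMap.sub_apply, LinearMap.sub_apply, Module.End.one_apply, Module.End.one_apply,
      sub_eq_sub_iff_add_eq_add]
    exact (h1.symm.trans h2).symm
  -- conclude `f g = ρ g a − a`
  have hfg : f g = A.ρ g ((↑u⁻¹ : Module.End k A) (f z)) - (↑u⁻¹ : Module.End k A) (f z) := by
    calc f g = (↑u⁻¹ * ↑u : Module.End k A) (f g) := by rw [Units.inv_mul, Module.End.one_apply]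
      _ = ((↑u⁻¹ : Module.End k A) * (A.ρ g - 1)) (f z) := by
          rw [Module.End.mul_apply, hkey, Module.End.mul_apply]
      _ = ((A.ρ g - 1) * (↑u⁻¹ : Module.End k A)) (f z) := by rw [hcomm'.eq]
      _ = A.ρ g ((↑u⁻¹ : Module.End k A) (f z)) - (↑u⁻¹ : Module.End k A) (f z) := by
          rw [Module.End.mul_apply, LinearMap.sub_apply, Module.End.one_apply]
  change A.ρ g ((↑u⁻¹ : Module.End k A) (f z)) - (↑u⁻¹ : Module.End k A) (f z) = f g
  exact hfg.symm

/-- **Sah's lemma**: under the same hypotheses `H¹(G, A) = 0`. [folklore] -/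
theorem isZero_H1_of_isUnit (z : G) (hz : ∀ g : G, g * z = z * g) (hu : IsUnit (A.ρ z - 1)) :
    Limits.IsZero (groupCohomology.H1 A) := by
  have hle := cocycles₁_le_coboundaries₁_of_isUnit A z hz hu
  haveI : Subsingleton (groupCohomology.H1 A) :=
    subsingleton_of_forall_eq 0 fun x ↦
      H1_induction_on x fun c ↦ (H1π_eq_zero_iff c).mpr (hle c.2)
  exact ModuleCat.isZero_of_subsingleton _

/-- **No invariants**: if `ρ(z) − 1` is invertible for some `z ∈ G` then `A^G = 0` (already
`A^z = 0`). [folklore] -/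
theorem invariants_eq_bot_of_isUnit (z : G) (hu : IsUnit (A.ρ z - 1)) :
    A.ρ.invariants = ⊥ := by
  rw [eq_bot_iff]
  intro v hv
  rw [Representation.mem_invariants] at hv
  obtain ⟨u, hu'⟩ := hu
  have h0 : (↑u : Module.End k A) v = 0 := by
    rw [hu', LinearMap.sub_apply, Module.End.one_apply, hv z, sub_self]
  rw [Submodule.mem_bot]
  calc v = (↑u⁻¹ * ↑u : Module.End k A) v := by rw [Units.inv_mul, Module.End.one_apply]
    _ = 0 := by rw [Module.End.mul_apply, h0, map_zero]

end General

/-! ### §2 The case `ρ(z) = −1` with `2` invertible -/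

section NegOne

variable {k G : Type u} [CommRing k] [Group G] (A : Rep k G)

/-- If `ρ(z) = −1` and `2 ∈ k^×` then `ρ(z) − 1 = −2` is invertible. [folklore] -/
theorem isUnit_rho_sub_one_of_eq_neg_one (z : G) (hneg : A.ρ z = -1) (h2 : IsUnit (2 : k)) :
    IsUnit (A.ρ z - 1) := by
  have h : A.ρ z - 1 = -(algebraMap k (Module.End k A) 2) := by
    rw [hneg, map_ofNat]; norm_num
  rw [h]
  exact (h2.map (algebraMap k (Module.End k A))).neg

/-- **`−1` in the image kills `H¹`**: if some central `z ∈ G` acts as `−1` on `A` and `2 ∈ k^×`,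
then `H¹(G, A) = 0`. The `p = 3` substitute for "`p ∤ #G`" (Howard 2004 §1.1 / Mazur–Rubin
(H.1)–(H.3)-type hypotheses): `k = ℤ/3^m`, `z = −1 ∈ ρ_{E,3^m}(G_K)`. [folklore] -/
theorem isZero_H1_of_eq_neg_one (z : G) (hz : ∀ g : G, g * z = z * g) (hneg : A.ρ z = -1)
    (h2 : IsUnit (2 : k)) : Limits.IsZero (groupCohomology.H1 A) :=
  isZero_H1_of_isUnit A z hz (isUnit_rho_sub_one_of_eq_neg_one A z hneg h2)

/-- **`−1` in the image kills the invariants**: if some `z ∈ G` acts as `−1` on `A` and `2 ∈ k^×`,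
then `A^G = 0`. [folklore] -/
theorem invariants_eq_bot_of_eq_neg_one (z : G) (hneg : A.ρ z = -1) (h2 : IsUnit (2 : k)) :
    A.ρ.invariants = ⊥ :=
  invariants_eq_bot_of_isUnit A z (isUnit_rho_sub_one_of_eq_neg_one A z hneg h2)

variable {M : Type u} [AddCommGroup M] [Module k M] (ρ : Representation k G M)

/-- **Concrete crossed-homomorphism form** (for consumers that do not use Mathlib's `H1`): for a
`k`-linear representation `ρ` of `G` on `M`, a central `z` with `ρ z = −1`, and `2 ∈ k^×`, every
crossed homomorphism `f : G → M` (`f(gh) = ρ(g) f(h) + f(g)`) is principal: `f(g) = ρ(g) a − a`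
for some `a ∈ M`. [folklore] -/
theorem exists_eq_sub_of_crossedHom_of_eq_neg_one (z : G) (hz : ∀ g : G, g * z = z * g)
    (hneg : ρ z = -1) (h2 : IsUnit (2 : k)) (f : G → M)
    (hf : ∀ g h : G, f (g * h) = ρ g (f h) + f g) :
    ∃ a : M, ∀ g : G, f g = ρ g a - a := by
  have hle := cocycles₁_le_coboundaries₁_of_isUnit (Rep.of ρ) z hz
    (isUnit_rho_sub_one_of_eq_neg_one (Rep.of ρ) z (by rw [Rep.of_ρ]; exact hneg) h2)
  have hmem : f ∈ cocycles₁ (Rep.of ρ) := (mem_cocycles₁_iff (A := Rep.of ρ) f).mpr hf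
  obtain ⟨a, ha⟩ := hle hmem
  refine ⟨a, fun g ↦ ?_⟩
  have := congrFun ha g
  exact this.symm

/-- **Concrete fixed-vector form**: with `ρ z = −1` and `2 ∈ k^×`, a vector fixed by `z` (a
fortiori by `G`) is `0`. [folklore] -/
theorem eq_zero_of_fixed_of_eq_neg_one (z : G) (hneg : ρ z = -1) (h2 : IsUnit (2 : k)) (v : M)
    (hv : ρ z v = v) : v = 0 := by
  rw [hneg, LinearMap.neg_apply, Module.End.one_apply] at hv
  -- `-v = v` ⇒ `2 • v = 0` ⇒ `v = 0`
  have h2v : (2 : k) • v = 0 := by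
    rw [two_smul]
    nth_rewrite 1 [← hv]
    exact neg_add_cancel v
  obtain ⟨w, hw⟩ := h2
  calc v = ((↑w⁻¹ : k) * ↑w) • v := by rw [Units.inv_mul, one_smul]
    _ = 0 := by rw [mul_smul, hw, h2v, smul_zero]

end NegOne

end Sah

/-! ### §3 The PLAN row: `−1 ∈ G ≤ GL₂(ℤ/3^m)` acting on `(ℤ/3^m)²` -/

namespace GL2

open Matrix

/-- `2` is a unit in `ℤ/3^m`. [folklore] -/
theorem isUnit_two_zmod_three_pow (m : ℕ) : IsUnit (2 : ZMod (3 ^ m)) := by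
  have h : Nat.Coprime 2 (3 ^ m) := Nat.Coprime.pow_right m (by decide)
  have := (ZMod.unitOfCoprime 2 h).isUnit
  rwa [ZMod.coe_unitOfCoprime, Nat.cast_ofNat] at this

variable {m : ℕ}

/-- **No fixed vectors**: if `−1 ∈ G ≤ GL₂(ℤ/3^m)` then a vector of `(ℤ/3^m)²` fixed by every
element of `G` is `0` (already `(−1)·v = v` forces `2v = 0`, and `2` is a unit). [folklore] -/
theorem eq_zero_of_forall_mulVec_eq (G : Subgroup (GL (Fin 2) (ZMod (3 ^ m))))
    (hG : (-1 : GL (Fin 2) (ZMod (3 ^ m))) ∈ G) (v : Fin 2 → ZMod (3 ^ m))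
    (hv : ∀ g ∈ G, ((g : GL (Fin 2) (ZMod (3 ^ m))) : Matrix (Fin 2) (Fin 2) (ZMod (3 ^ m))) *ᵥ v = v) :
    v = 0 := by
  have h := hv (-1) hG
  rw [Units.val_neg, Units.val_one, Matrix.neg_mulVec, Matrix.one_mulVec] at h
  have h2v : (2 : ZMod (3 ^ m)) • v = 0 := by
    rw [two_smul]
    nth_rewrite 1 [← h]
    exact neg_add_cancel v
  obtain ⟨w, hw⟩ := isUnit_two_zmod_three_pow m
  calc v = ((↑w⁻¹ : ZMod (3 ^ m)) * ↑w) • v := by rw [Units.inv_mul, one_smul]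
    _ = 0 := by rw [mul_smul, hw, h2v, smul_zero]

/-- **Every crossed homomorphism is principal**: if `−1 ∈ G ≤ GL₂(ℤ/3^m)` then every
`f : G → (ℤ/3^m)²` with `f(gh) = g · f(h) + f(g)` is of the form `f(g) = g · a − a` — i.e.
`H¹(G, (ℤ/3^m)²) = 0` (Sah's lemma with the central element `−1`, `ρ(−1) − 1 = −2 ∈ GL`).
[folklore] -/
theorem exists_eq_mulVec_sub_of_crossedHom (G : Subgroup (GL (Fin 2) (ZMod (3 ^ m))))
    (hG : (-1 : GL (Fin 2) (ZMod (3 ^ m))) ∈ G) (f : G → (Fin 2 → ZMod (3 ^ m)))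
    (hf : ∀ g h : G, f (g * h) =
      ((g : GL (Fin 2) (ZMod (3 ^ m))) : Matrix (Fin 2) (Fin 2) (ZMod (3 ^ m))) *ᵥ f h + f g) :
    ∃ a : Fin 2 → ZMod (3 ^ m), ∀ g : G,
      f g = ((g : GL (Fin 2) (ZMod (3 ^ m))) : Matrix (Fin 2) (Fin 2) (ZMod (3 ^ m))) *ᵥ a - a := by
  -- the linear representation of `G` on `(ℤ/3^m)²` by matrix multiplication
  set ρ : Representation (ZMod (3 ^ m)) G (Fin 2 → ZMod (3 ^ m)) :=
    { toFun := fun g ↦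
        Matrix.mulVecLin (((g : GL (Fin 2) (ZMod (3 ^ m)))) : Matrix (Fin 2) (Fin 2) (ZMod (3 ^ m)))
      map_one' := by
        apply LinearMap.ext; intro v
        simp
      map_mul' := fun g h ↦ by
        apply LinearMap.ext; intro v
        simp [Matrix.mulVec_mulVec] } with hρdef
  have hρ : ∀ (g : G) (v : Fin 2 → ZMod (3 ^ m)),
      ρ g v = ((g : GL (Fin 2) (ZMod (3 ^ m))) : Matrix (Fin 2) (Fin 2) (ZMod (3 ^ m))) *ᵥ v :=
    fun g v ↦ rfl
  -- the central element `−1 ∈ G` acts as `−1`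
  set z : G := ⟨-1, hG⟩ with hzdef
  have hz : ∀ g : G, g * z = z * g := fun g ↦ by
    apply Subtype.ext
    change (g : GL (Fin 2) (ZMod (3 ^ m))) * (-1) = (-1) * (g : GL (Fin 2) (ZMod (3 ^ m)))
    rw [mul_neg_one, neg_one_mul]
  have hneg : ρ z = -1 := by
    apply LinearMap.ext
    intro v
    rw [hρ, LinearMap.neg_apply, Module.End.one_apply]
    change (((-1 : GL (Fin 2) (ZMod (3 ^ m)))) : Matrix (Fin 2) (Fin 2) (ZMod (3 ^ m))) *ᵥ v = -v
    rw [Units.val_neg, Units.val_one, Matrix.neg_mulVec, Matrix.one_mulVec]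
  obtain ⟨a, ha⟩ := Sah.exists_eq_sub_of_crossedHom_of_eq_neg_one ρ z hz hneg
    (isUnit_two_zmod_three_pow m) f (fun g h ↦ by rw [hρ]; exact hf g h)
  exact ⟨a, fun g ↦ by rw [ha g, hρ]⟩

end GL2

end Summit.BirchSwinnertonDyer.Rank1Residual.X11b.Three
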